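import Summits.QuantumFields.BalabanUV.T4Continuum.Support.B13StepEndOn
import Summits.QuantumFields.BalabanUV.T4Continuum.Support.B13StepEndArithmeticWindow

/-!
# NE5 ∕ U3 — E1[rec] ON THE R20 SUB-SLOT WITH THE ARITHMETIC LETTERS ELIMINATED: per pair of runs (`∃ C₅`), η-UNIFORM (`∃ C₅, ∀ R S₀ M …`)
# and WINDOWWISE (R24 × R29′) — row O6-n follower of leaf-09-g2's `B13StepEndOn` (p217146: the termwise END re-pointed to the measurable
# operator carrier in the owner's R21 per-domain currency), pattern of this lineage's `B13StepEndArithmetic` (N69) ∕ `B13StepEndArithmeticWindow`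

Cell `pub-balaban`, unit `b2b-balaban-t4-ne5-formalise-leaf-10` (NE5 formalisation swarm, LEAF PROVER 10, gen 5; journal OFFER `CLAIMS.log`
l.12169, taken up by the END author leaf-09-g2 l.12459∕l.12620, INTENT l.12672; CLAIM RULE 1).  Summits-side new work under the LEAN PLACEMENT
RULE (cell bookkeeping; NOT a Literature module; 0 `def`, 0 cite tag); nothing landed is edited — leaf-09's faces and this lineage's
arithmetic are applied BY NAME.  HONEST FRAMING: rung (B)+1 of the FINITE-VOLUME T⁴ continuum programme — NOT infinite volume, NOT a mass
gap, NOT the Clay problem, and **NOT A PROOF OF NE5** (NOT PRINTED in [Balaban1987RG1]–[Balaban1989LargeFieldII], which print ε-UNIFORM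
bounds, never η-RATES; GAPS G-t4-U3-1): every theorem is an IMPLICATION whose wall binders — W1 in row NE2's entry currency, the termwise W2
data of the (2.14)-terms on the sub-slot class in the PER-DOMAIN currency (`TermBoundLoc`∕`TermBudgetLoc`∕`TermLineAnalytic`, GAPS
G-ne5p1-1′, NOT PRINTED; [II] (2.38) p. 20 ∕ (2.41) p. 21 are locators of KIND only), the one-run slice budgets (W3 KIND), W4, the quoted
levels L05∕L06 ([Balaban1987RG1] (1.18) p. 263 — SHAPE only), room — are DISPLAYED HYPOTHESES, asserted nowhere.  HONEST DEPENDENCY (cell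
line, verbatim): continuum YM on T⁴ ⇐ BetaPertH ∧ nine spine estimates (0/9 proved); BetaPertH ⇐ (D1) ∧ (D4) ∧ CAP+tail; G-an2-4 gates
asym, D1 and NE2/3/4.

WHAT THIS FILE DOES (compositions BY NAME; no estimate of its own).  The R20 caveat (G-ne5p2-5 class: over `ℓ^∞(E)` an operator-ball
binder quantifies over directions with non-measurable `x`-sections) is lifted for E1[rec] by leaf-09's `B13StepEndOn.ne5_of_record_restrict_loc`
— same root `NE5 (B13StepOfRecord.outA S₀ E₀ cB) (B13StepOfRecord.outB S₀ E₀ cB) …`, W2 displayed on the SUB-SLOT class (directions IN `M`).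
Here its five arithmetic binders `hρ₀`∕`hnear`∕`hB`∕`hfirst`∕`hsmall` over the letters `ρ₀, k₀, B` are REPLACED by `0 < θ < 1` and the two
strict size inequalities `cA(EA₀ + E₀) < 1 − ω`, `ω + G·cA·(1 − ω)∕(1 − ω − cA(EA₀ + E₀)) < θ′` (this lineage's `reach_elim_iff` ∕
`reach_binders_exists` ∕ `smallness_of_gain`, `E₁ := 1`; nothing lost: `arithmetic_letters_iff`):
* §1 `exists_ne5_of_record_onSub_loc` ∕ **`exists_ne5_of_record_restrict_loc`** — per instance, `∃ C₅`.  (R29′: `∃`-AFTER-`W` faces, terminal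
  for their window unless a common bound is displayed.)
* §2 `uniform_ne5_of_record_onSub_loc` ∕ **`uniform_ne5_of_record_restrict_loc`** — `∃ C₅` OUTERMOST: ONE constant from the SIZES for every
  pair of runs `R`, slot package `S₀` (`S₀.D.ω = ω`), SUB-SLOT `M ∋` the data of record (of record `M := measOp`, membership by leaf-03's
  `opA_mem_measOp`∕`opB_mem_measOp`), cores on `↥M` (onSub) ∕ the cores of record (restrict), window `W` and class `ROp, RHist, a`.
* §3 **`uniform_ne5_of_record_restrict_loc_singleton`** — §2 read WINDOWWISE (owner R24 × R29′; `B13StepEndArithmeticWindow` pattern): every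
  window-dependent binder at the singleton `{g}`, a g-INDEXED per-domain dictionary `a g` with the COMMON budget `G`, the SAME `C₅`
  (`OutputRateWindow.ne5_of_forall_singleton`).
0 sorry; axioms ⊆ {propext, Classical.choice, Quot.sound}.  Part 2's twins (leaf-09's `B13StepEndLoc`, the R21 (2.14)-dictionary face) are NOT
here (separate module once it is in the tree).
-/

noncomputable section

open Metric Set

namespace Summit.QuantumFields.BalabanUV.T4Continuum.B13StepEndSubArithmetic

open Literature.MathematicalPhysics.QuantumFieldTheory.Balaban1983to89
open Literature.MathematicalPhysics.QuantumFieldTheory.Balaban1983to89.T4OutputRate (Carriers Functional DecayBound NE5)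
open Literature.MathematicalPhysics.QuantumFieldTheory.Balaban1983to89.T4InputCauchyRateSpecies (ballClass)
open Literature.MathematicalPhysics.QuantumFieldTheory.Balaban1983to89.T4InputCauchyRateTermwise (TermLineAnalytic)
open Summit.QuantumFields.BalabanUV.T4Continuum.B13Carriers (TwoRuns)
open Summit.QuantumFields.BalabanUV.T4Continuum.B13OpDatum (OpDatum)
open Summit.QuantumFields.BalabanUV.T4Continuum.B13OpDatumJunctions (opOf RawBounded WeightedEntrywiseRate)
open Summit.QuantumFields.BalabanUV.T4Continuum.B13StepTermLabels (TermIdx InnerLabel)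
open Summit.QuantumFields.BalabanUV.T4Continuum.B13StepTermFamily (term)
open Summit.QuantumFields.BalabanUV.T4Continuum.B13InnerData (Bnd)
open Summit.QuantumFields.BalabanUV.T4Continuum.B13Base (selfCtr)
open Summit.QuantumFields.BalabanUV.T4Continuum.B13StepOfRecord (Slots assembly step)
open Summit.QuantumFields.BalabanUV.T4Continuum.B13StepOfRecordSub (assemblyOn stepOn onSub restrict outA outB)
open Summit.QuantumFields.BalabanUV.T4Continuum.OutputRateTermwiseLoc (TermBoundLoc TermBudgetLoc)
open Summit.QuantumFields.BalabanUV.T4Continuum.B13StepEndOn (ne5_of_record_onSub_loc ne5_of_record_restrict_loc)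
open Summit.QuantumFields.BalabanUV.T4Continuum.B13StepEndArithmetic (reach_elim_iff smallness_of_gain)
open Summit.QuantumFields.BalabanUV.T4Continuum.OutputRateArithmetic (reach_binders_exists)
open Summit.QuantumFields.BalabanUV.T4Continuum.OutputRateWindow (ne5_of_forall_singleton)

/-! ## §1 Per pair of runs: the letters `ρ₀`, `k₀`, `B` eliminated -/

section PerInstance

variable {𝔾 : Type} [GaugeGroup 𝔾] {R : TwoRuns 𝔾} {E IOp Hist : Type*} [NormedAddCommGroup Hist] [NormedSpace ℂ Hist]
  (S₀ : Slots R E IOp Hist) (M : Submodule ℂ (OpDatum E))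
  (hMA : ∀ g V k, opOf S₀.F S₀.rawA g V k ∈ M) (hMB : ∀ g U k, opOf S₀.F S₀.rawB g U k ∈ M)
  (act : R.carriers.Dom → InnerLabel R.carriers.Dom (Bnd R) → M → Hist → ℂ) (E₀ cB : ℝ)

/-- [folklore] **E1[rec] ON THE SUB-SLOT WITH CORES TYPED ON `↥M`, ARITHMETIC LETTERS ELIMINATED** — leaf-09's
`B13StepEndOn.ne5_of_record_onSub_loc` with `hρ₀`∕`hnear`∕`hB`∕`hfirst`∕`hsmall` over `ρ₀, k₀, B` REPLACED by `0 < θ < 1` and the two strict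
size inequalities; every analytic binder BY NAME and unchanged (reading, slice budgets, W4 and W1's entry data ON THE MODEL OF RECORD; levels of
the sub-slot model's outputs; termwise W2 data of `act` on the sub-slot class in the per-domain currency; room).  `∃ C₅` per instance. -/
theorem exists_ne5_of_record_onSub_loc {W : Set (ℕ → ℝ)} {ROp RHist : ℕ → ℝ}
    {a : ℕ → TermIdx R.carriers.Dom (Bnd R) → R.carriers.Dom → ℝ} {κ G EA₀ cA c₁ r₀ δ' θ θ' : ℝ}
    (hT : (assembly S₀).TransportReads W)
    (hbB : (assembly S₀).SliceBudgetB W κ cB) (hbA : S₀.D.SliceBudget (step S₀ E₀ cB) W κ cA)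
    (hdA : DecayBound (outA (onSub S₀ M hMA hMB act) E₀ cB) W EA₀ κ)
    (hdB : DecayBound (outB (onSub S₀ M hMA hMB act) E₀ cB) W E₀ κ)
    (hRA : RawBounded S₀.F (assembly S₀).rawAt W) (hRB : RawBounded S₀.F S₀.rawB W)
    (hwer : WeightedEntrywiseRate S₀.F (assembly S₀).rawAt S₀.rawB W c₁ fun k => θ ^ k) (hfl : ∀ k, r₀ ≤ S₀.rOp k)
    (hins : (step S₀ E₀ cB).InsertionRate W κ E₀ δ' θ)
    (hbd : TermBoundLoc (ballClass (selfCtr (assemblyOn (onSub S₀ M hMA hMB act)).raw (assemblyOn (onSub S₀ M hMA hMB act)).histRef)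
      ROp RHist) (term (assemblyOn (onSub S₀ M hMA hMB act)).𝒯 (assemblyOn (onSub S₀ M hMA hMB act)).inc act) W κ a)
    (hbud : TermBudgetLoc a G)
    (hline : TermLineAnalytic (ballClass (selfCtr (assemblyOn (onSub S₀ M hMA hMB act)).raw
      (assemblyOn (onSub S₀ M hMA hMB act)).histRef) ROp RHist)
      (term (assemblyOn (onSub S₀ M hMA hMB act)).𝒯 (assemblyOn (onSub S₀ M hMA hMB act)).inc act) W)
    (hOp : ∀ k, S₀.rOp k ≤ ROp k) (hHist : ∀ k, (assembly S₀).bHist E₀ cB k + S₀.rHist k ≤ RHist k)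
    (hE₀ : 0 ≤ E₀) (hG : 0 ≤ G) (hcA : 0 ≤ cA) (hcB : 0 ≤ cB) (hc₁ : 0 ≤ c₁) (hr₀ : 0 < r₀) (hδ' : 0 ≤ δ')
    (hθ0 : 0 < θ) (hθ1 : θ < 1) (hθθ' : θ ≤ θ') (hθ'1 : θ' ≤ 1) (hω : 0 < S₀.D.ω) (hω1 : S₀.D.ω < 1)
    (hh : cA * (EA₀ + E₀) < 1 - S₀.D.ω)
    (hsmall : S₀.D.ω + G * cA * (1 - S₀.D.ω) / (1 - S₀.D.ω - cA * (EA₀ + E₀)) < θ') :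
    ∃ C₅, NE5 (outA (onSub S₀ M hMA hMB act) E₀ cB) (outB (onSub S₀ M hMA hMB act) E₀ cB) W κ θ' C₅ := by
  obtain ⟨ρ₀, hreach, hρ₀, hs⟩ := (reach_elim_iff (mul_nonneg hG hcA) hω1).mpr ⟨hh, hsmall⟩
  obtain ⟨k₀, B, hB, hnear, hfirst⟩ :=
    reach_binders_exists (D := c₁ / r₀ + δ') (add_nonneg (div_nonneg hc₁ hr₀.le) hδ') hθ0 hθ1 hreach
  exact ⟨_, ne5_of_record_onSub_loc S₀ M hMA hMB act E₀ cB hT hbB hbA hdA hdB hRA hRB hwer hfl hins hbd hbud hline hOp hHist hE₀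
    one_pos hG hcA hcB hc₁ hr₀ hδ' hθ0.le hθθ' hθ'1 hω hω1 hρ₀ hnear hB hfirst (smallness_of_gain hs)⟩

/-- [folklore] **E1[rec] ON THE SUB-SLOT WITH THE CORES OF RECORD RESTRICTED TO `M`, ARITHMETIC LETTERS ELIMINATED** — leaf-09's
`B13StepEndOn.ne5_of_record_restrict_loc` (root LITERALLY on `B13StepOfRecord.outA∕outB S₀ E₀ cB`; W2 displayed on the sub-slot class —
directions IN `M`, the R20 form) without `ρ₀, k₀, B`: `∃ C₅, NE5 (B13StepOfRecord.outA S₀ E₀ cB) (B13StepOfRecord.outB S₀ E₀ cB) W κ θ′ C₅`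
from the displayed analytic binders, `0 < θ < 1`, `θ ≤ θ′ ≤ 1` and the two strict size inequalities. -/
theorem exists_ne5_of_record_restrict_loc {W : Set (ℕ → ℝ)} {ROp RHist : ℕ → ℝ}
    {a : ℕ → TermIdx R.carriers.Dom (Bnd R) → R.carriers.Dom → ℝ} {κ G EA₀ cA c₁ r₀ δ' θ θ' : ℝ}
    (hT : (assembly S₀).TransportReads W)
    (hbB : (assembly S₀).SliceBudgetB W κ cB) (hbA : S₀.D.SliceBudget (step S₀ E₀ cB) W κ cA)
    (hdA : DecayBound (B13StepOfRecord.outA S₀ E₀ cB) W EA₀ κ) (hdB : DecayBound (B13StepOfRecord.outB S₀ E₀ cB) W E₀ κ)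
    (hRA : RawBounded S₀.F (assembly S₀).rawAt W) (hRB : RawBounded S₀.F S₀.rawB W)
    (hwer : WeightedEntrywiseRate S₀.F (assembly S₀).rawAt S₀.rawB W c₁ fun k => θ ^ k) (hfl : ∀ k, r₀ ≤ S₀.rOp k)
    (hins : (step S₀ E₀ cB).InsertionRate W κ E₀ δ' θ)
    (hbd : TermBoundLoc (ballClass (selfCtr (assemblyOn (restrict S₀ M hMA hMB)).raw (assemblyOn (restrict S₀ M hMA hMB)).histRef)
      ROp RHist) (term (assemblyOn (restrict S₀ M hMA hMB)).𝒯 (assemblyOn (restrict S₀ M hMA hMB)).inc (restrict S₀ M hMA hMB).act) W κ a)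
    (hbud : TermBudgetLoc a G)
    (hline : TermLineAnalytic (ballClass (selfCtr (assemblyOn (restrict S₀ M hMA hMB)).raw
      (assemblyOn (restrict S₀ M hMA hMB)).histRef) ROp RHist)
      (term (assemblyOn (restrict S₀ M hMA hMB)).𝒯 (assemblyOn (restrict S₀ M hMA hMB)).inc (restrict S₀ M hMA hMB).act) W)
    (hOp : ∀ k, S₀.rOp k ≤ ROp k) (hHist : ∀ k, (assembly S₀).bHist E₀ cB k + S₀.rHist k ≤ RHist k)
    (hE₀ : 0 ≤ E₀) (hG : 0 ≤ G) (hcA : 0 ≤ cA) (hcB : 0 ≤ cB) (hc₁ : 0 ≤ c₁) (hr₀ : 0 < r₀) (hδ' : 0 ≤ δ')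
    (hθ0 : 0 < θ) (hθ1 : θ < 1) (hθθ' : θ ≤ θ') (hθ'1 : θ' ≤ 1) (hω : 0 < S₀.D.ω) (hω1 : S₀.D.ω < 1)
    (hh : cA * (EA₀ + E₀) < 1 - S₀.D.ω)
    (hsmall : S₀.D.ω + G * cA * (1 - S₀.D.ω) / (1 - S₀.D.ω - cA * (EA₀ + E₀)) < θ') :
    ∃ C₅, NE5 (B13StepOfRecord.outA S₀ E₀ cB) (B13StepOfRecord.outB S₀ E₀ cB) W κ θ' C₅ := by
  obtain ⟨ρ₀, hreach, hρ₀, hs⟩ := (reach_elim_iff (mul_nonneg hG hcA) hω1).mpr ⟨hh, hsmall⟩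
  obtain ⟨k₀, B, hB, hnear, hfirst⟩ :=
    reach_binders_exists (D := c₁ / r₀ + δ') (add_nonneg (div_nonneg hc₁ hr₀.le) hδ') hθ0 hθ1 hreach
  exact ⟨_, ne5_of_record_restrict_loc S₀ M hMA hMB E₀ cB hT hbB hbA hdA hdB hRA hRB hwer hfl hins hbd hbud hline hOp hHist hE₀ one_pos
    hG hcA hcB hc₁ hr₀ hδ' hθ0.le hθθ' hθ'1 hω hω1 hρ₀ hnear hB hfirst (smallness_of_gain hs)⟩

end PerInstance

/-! ## §2 η-uniform: ONE constant for every pair of runs, slot package, sub-slot, window and class -/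

section Uniform

/-- [folklore] **E1[rec] ON THE SUB-SLOT (CORES ON `↥M`) WITH A CONSTANT UNIFORM IN THE PAIR OF RUNS AND IN THE SUB-SLOT.**  Fix the SIZES
`κ, G, EA₀, E₀, cA, cB, c₁, r₀, δ′`, `0 < θ < 1`, `θ ≤ θ′ ≤ 1`, `0 < ω < 1` subject to `cA(EA₀ + E₀) < 1 − ω` and
`ω + G·cA·(1 − ω)∕(1 − ω − cA(EA₀ + E₀)) < θ′`.  Then ONE `C₅` serves EVERY pair of runs `R`, slot package `S₀` with `S₀.D.ω = ω`, sub-slot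
`M ∋` the data of record, cores `act` on `↥M`, window `W` and class `ROp, RHist, a`: the displayed binders of
`B13StepEndOn.ne5_of_record_onSub_loc` imply `NE5 (outA (onSub S₀ M hMA hMB act) E₀ cB) (outB (onSub …) E₀ cB) W κ θ′ C₅`.
The η-uniformity is the quantifier order `∃ C₅, ∀ R S₀ M …`.  NOT a proof of NE5: an implication from displayed binders. -/
theorem uniform_ne5_of_record_onSub_loc {κ G EA₀ E₀ cA cB c₁ r₀ δ' θ θ' ω : ℝ}
    (hE₀ : 0 ≤ E₀) (hG : 0 ≤ G) (hcA : 0 ≤ cA) (hcB : 0 ≤ cB) (hc₁ : 0 ≤ c₁) (hr₀ : 0 < r₀) (hδ' : 0 ≤ δ')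
    (hθ0 : 0 < θ) (hθ1 : θ < 1) (hθθ' : θ ≤ θ') (hθ'1 : θ' ≤ 1) (hω : 0 < ω) (hω1 : ω < 1)
    (hh : cA * (EA₀ + E₀) < 1 - ω) (hsmall : ω + G * cA * (1 - ω) / (1 - ω - cA * (EA₀ + E₀)) < θ') :
    ∃ C₅ : ℝ, ∀ {𝔾 : Type} [GaugeGroup 𝔾] {R : TwoRuns 𝔾} {E IOp Hist : Type*} [NormedAddCommGroup Hist] [NormedSpace ℂ Hist]
      (S₀ : Slots R E IOp Hist) (M : Submodule ℂ (OpDatum E))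
      (hMA : ∀ g V k, opOf S₀.F S₀.rawA g V k ∈ M) (hMB : ∀ g U k, opOf S₀.F S₀.rawB g U k ∈ M)
      (act : R.carriers.Dom → InnerLabel R.carriers.Dom (Bnd R) → M → Hist → ℂ)
      {W : Set (ℕ → ℝ)} {ROp RHist : ℕ → ℝ} {a : ℕ → TermIdx R.carriers.Dom (Bnd R) → R.carriers.Dom → ℝ},
      S₀.D.ω = ω →
      (assembly S₀).TransportReads W →
      (assembly S₀).SliceBudgetB W κ cB → S₀.D.SliceBudget (step S₀ E₀ cB) W κ cA →
      DecayBound (outA (onSub S₀ M hMA hMB act) E₀ cB) W EA₀ κ → DecayBound (outB (onSub S₀ M hMA hMB act) E₀ cB) W E₀ κ →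
      RawBounded S₀.F (assembly S₀).rawAt W → RawBounded S₀.F S₀.rawB W →
      WeightedEntrywiseRate S₀.F (assembly S₀).rawAt S₀.rawB W c₁ (fun k => θ ^ k) → (∀ k, r₀ ≤ S₀.rOp k) →
      (step S₀ E₀ cB).InsertionRate W κ E₀ δ' θ →
      TermBoundLoc (ballClass (selfCtr (assemblyOn (onSub S₀ M hMA hMB act)).raw (assemblyOn (onSub S₀ M hMA hMB act)).histRef)
        ROp RHist) (term (assemblyOn (onSub S₀ M hMA hMB act)).𝒯 (assemblyOn (onSub S₀ M hMA hMB act)).inc act) W κ a →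
      TermBudgetLoc a G →
      TermLineAnalytic (ballClass (selfCtr (assemblyOn (onSub S₀ M hMA hMB act)).raw
        (assemblyOn (onSub S₀ M hMA hMB act)).histRef) ROp RHist)
        (term (assemblyOn (onSub S₀ M hMA hMB act)).𝒯 (assemblyOn (onSub S₀ M hMA hMB act)).inc act) W →
      (∀ k, S₀.rOp k ≤ ROp k) → (∀ k, (assembly S₀).bHist E₀ cB k + S₀.rHist k ≤ RHist k) →
      NE5 (outA (onSub S₀ M hMA hMB act) E₀ cB) (outB (onSub S₀ M hMA hMB act) E₀ cB) W κ θ' C₅ := by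
  obtain ⟨ρ₀, hreach, hρ₀, hs⟩ := (reach_elim_iff (mul_nonneg hG hcA) hω1).mpr ⟨hh, hsmall⟩
  obtain ⟨k₀, B, hB, hnear, hfirst⟩ :=
    reach_binders_exists (D := c₁ / r₀ + δ') (add_nonneg (div_nonneg hc₁ hr₀.le) hδ') hθ0 hθ1 hreach
  refine ⟨(G / (1 - ρ₀) * (c₁ / r₀) + G / (1 - ρ₀) * δ' + B) * (θ' - ω) / (θ' - (ω + G / (1 - ρ₀) * cA)), ?_⟩
  intro 𝔾 _ R E IOp Hist _ _ S₀ M hMA hMB act W ROp RHist a hSω hT hbB hbA hdA hdB hRA hRB hwer hfl hins hbd hbud hline hOp hHist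
  subst hSω
  exact ne5_of_record_onSub_loc S₀ M hMA hMB act E₀ cB hT hbB hbA hdA hdB hRA hRB hwer hfl hins hbd hbud hline hOp hHist hE₀ one_pos
    hG hcA hcB hc₁ hr₀ hδ' hθ0.le hθθ' hθ'1 hω hω1 hρ₀ hnear hB hfirst (smallness_of_gain hs)

/-- [folklore] **E1[rec] RE-POINTED (R20) WITH A CONSTANT UNIFORM IN THE PAIR OF RUNS AND IN THE SUB-SLOT — ROOT ON THE OUTPUTS OF RECORD.**
As `uniform_ne5_of_record_onSub_loc` for the cores OF RECORD restricted to `M` (`B13StepOfRecordSub.restrict`): ONE `C₅` from the sizes such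
that for EVERY pair of runs, slot package (`S₀.D.ω = ω`), sub-slot `M ∋` the data of record (of record `M := measOp`), window and class, the
displayed binders of `B13StepEndOn.ne5_of_record_restrict_loc` imply `NE5 (B13StepOfRecord.outA S₀ E₀ cB) (B13StepOfRecord.outB S₀ E₀ cB) W κ θ′ C₅`.
This is N69's `uniform_ne5_of_record` with the W2 data moved to the sub-slot class (directions IN `M`) and the budget read PER DOMAIN (R21).
NOT a proof of NE5: an implication from displayed binders. -/
theorem uniform_ne5_of_record_restrict_loc {κ G EA₀ E₀ cA cB c₁ r₀ δ' θ θ' ω : ℝ}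
    (hE₀ : 0 ≤ E₀) (hG : 0 ≤ G) (hcA : 0 ≤ cA) (hcB : 0 ≤ cB) (hc₁ : 0 ≤ c₁) (hr₀ : 0 < r₀) (hδ' : 0 ≤ δ')
    (hθ0 : 0 < θ) (hθ1 : θ < 1) (hθθ' : θ ≤ θ') (hθ'1 : θ' ≤ 1) (hω : 0 < ω) (hω1 : ω < 1)
    (hh : cA * (EA₀ + E₀) < 1 - ω) (hsmall : ω + G * cA * (1 - ω) / (1 - ω - cA * (EA₀ + E₀)) < θ') :
    ∃ C₅ : ℝ, ∀ {𝔾 : Type} [GaugeGroup 𝔾] {R : TwoRuns 𝔾} {E IOp Hist : Type*} [NormedAddCommGroup Hist] [NormedSpace ℂ Hist]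
      (S₀ : Slots R E IOp Hist) (M : Submodule ℂ (OpDatum E))
      (hMA : ∀ g V k, opOf S₀.F S₀.rawA g V k ∈ M) (hMB : ∀ g U k, opOf S₀.F S₀.rawB g U k ∈ M)
      {W : Set (ℕ → ℝ)} {ROp RHist : ℕ → ℝ} {a : ℕ → TermIdx R.carriers.Dom (Bnd R) → R.carriers.Dom → ℝ},
      S₀.D.ω = ω →
      (assembly S₀).TransportReads W →
      (assembly S₀).SliceBudgetB W κ cB → S₀.D.SliceBudget (step S₀ E₀ cB) W κ cA →
      DecayBound (B13StepOfRecord.outA S₀ E₀ cB) W EA₀ κ → DecayBound (B13StepOfRecord.outB S₀ E₀ cB) W E₀ κ →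
      RawBounded S₀.F (assembly S₀).rawAt W → RawBounded S₀.F S₀.rawB W →
      WeightedEntrywiseRate S₀.F (assembly S₀).rawAt S₀.rawB W c₁ (fun k => θ ^ k) → (∀ k, r₀ ≤ S₀.rOp k) →
      (step S₀ E₀ cB).InsertionRate W κ E₀ δ' θ →
      TermBoundLoc (ballClass (selfCtr (assemblyOn (restrict S₀ M hMA hMB)).raw (assemblyOn (restrict S₀ M hMA hMB)).histRef)
        ROp RHist) (term (assemblyOn (restrict S₀ M hMA hMB)).𝒯 (assemblyOn (restrict S₀ M hMA hMB)).inc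
          (restrict S₀ M hMA hMB).act) W κ a →
      TermBudgetLoc a G →
      TermLineAnalytic (ballClass (selfCtr (assemblyOn (restrict S₀ M hMA hMB)).raw
        (assemblyOn (restrict S₀ M hMA hMB)).histRef) ROp RHist)
        (term (assemblyOn (restrict S₀ M hMA hMB)).𝒯 (assemblyOn (restrict S₀ M hMA hMB)).inc (restrict S₀ M hMA hMB).act) W →
      (∀ k, S₀.rOp k ≤ ROp k) → (∀ k, (assembly S₀).bHist E₀ cB k + S₀.rHist k ≤ RHist k) →
      NE5 (B13StepOfRecord.outA S₀ E₀ cB) (B13StepOfRecord.outB S₀ E₀ cB) W κ θ' C₅ := by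
  obtain ⟨ρ₀, hreach, hρ₀, hs⟩ := (reach_elim_iff (mul_nonneg hG hcA) hω1).mpr ⟨hh, hsmall⟩
  obtain ⟨k₀, B, hB, hnear, hfirst⟩ :=
    reach_binders_exists (D := c₁ / r₀ + δ') (add_nonneg (div_nonneg hc₁ hr₀.le) hδ') hθ0 hθ1 hreach
  refine ⟨(G / (1 - ρ₀) * (c₁ / r₀) + G / (1 - ρ₀) * δ' + B) * (θ' - ω) / (θ' - (ω + G / (1 - ρ₀) * cA)), ?_⟩
  intro 𝔾 _ R E IOp Hist _ _ S₀ M hMA hMB W ROp RHist a hSω hT hbB hbA hdA hdB hRA hRB hwer hfl hins hbd hbud hline hOp hHist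
  subst hSω
  exact ne5_of_record_restrict_loc S₀ M hMA hMB E₀ cB hT hbB hbA hdA hdB hRA hRB hwer hfl hins hbd hbud hline hOp hHist hE₀ one_pos hG
    hcA hcB hc₁ hr₀ hδ' hθ0.le hθθ' hθ'1 hω hω1 hρ₀ hnear hB hfirst (smallness_of_gain hs)

end Uniform

/-! ## §3 Windowwise (R24 × R29′): g-indexed per-domain dictionary, the SAME constant -/

section Windowwise

/-- [folklore] **E1[rec] RE-POINTED, η-UNIFORM AND g-UNIFORM ACROSS SINGLETON WINDOWS.**  §2's `uniform_ne5_of_record_restrict_loc` read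
WINDOWWISE: ONE `C₅` from the sizes such that for every pair of runs, slot package (`S₀.D.ω = ω`), sub-slot `M`, window `W` AND EVERY COUPLING
`g ∈ W` SEPARATELY — each displayed binder supplied at the singleton window `{g}`, the termwise per-domain dictionary g-INDEXED (`a g`, COMMON
budget `G`; R24's «g-indexed dictionaries on singleton windows») — `NE5 (B13StepOfRecord.outA S₀ E₀ cB) (B13StepOfRecord.outB S₀ E₀ cB) W κ θ′ C₅`
(`OutputRateWindow.ne5_of_forall_singleton`; R29′ (a): `∃ C₅` OUTERMOST, no cost in the constant).  NOT a proof of NE5. -/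
theorem uniform_ne5_of_record_restrict_loc_singleton {κ G EA₀ E₀ cA cB c₁ r₀ δ' θ θ' ω : ℝ}
    (hE₀ : 0 ≤ E₀) (hG : 0 ≤ G) (hcA : 0 ≤ cA) (hcB : 0 ≤ cB) (hc₁ : 0 ≤ c₁) (hr₀ : 0 < r₀) (hδ' : 0 ≤ δ')
    (hθ0 : 0 < θ) (hθ1 : θ < 1) (hθθ' : θ ≤ θ') (hθ'1 : θ' ≤ 1) (hω : 0 < ω) (hω1 : ω < 1)
    (hh : cA * (EA₀ + E₀) < 1 - ω) (hsmall : ω + G * cA * (1 - ω) / (1 - ω - cA * (EA₀ + E₀)) < θ') :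
    ∃ C₅ : ℝ, ∀ {𝔾 : Type} [GaugeGroup 𝔾] {R : TwoRuns 𝔾} {E IOp Hist : Type*} [NormedAddCommGroup Hist] [NormedSpace ℂ Hist]
      (S₀ : Slots R E IOp Hist) (M : Submodule ℂ (OpDatum E))
      (hMA : ∀ g V k, opOf S₀.F S₀.rawA g V k ∈ M) (hMB : ∀ g U k, opOf S₀.F S₀.rawB g U k ∈ M)
      {W : Set (ℕ → ℝ)} {ROp RHist : ℕ → ℝ} {a : (ℕ → ℝ) → ℕ → TermIdx R.carriers.Dom (Bnd R) → R.carriers.Dom → ℝ},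
      S₀.D.ω = ω →
      (∀ g ∈ W, (assembly S₀).TransportReads {g}) →
      (∀ g ∈ W, (assembly S₀).SliceBudgetB {g} κ cB) → (∀ g ∈ W, S₀.D.SliceBudget (step S₀ E₀ cB) {g} κ cA) →
      (∀ g ∈ W, DecayBound (B13StepOfRecord.outA S₀ E₀ cB) {g} EA₀ κ) →
      (∀ g ∈ W, DecayBound (B13StepOfRecord.outB S₀ E₀ cB) {g} E₀ κ) →
      (∀ g ∈ W, RawBounded S₀.F (assembly S₀).rawAt {g}) → (∀ g ∈ W, RawBounded S₀.F S₀.rawB {g}) →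
      (∀ g ∈ W, WeightedEntrywiseRate S₀.F (assembly S₀).rawAt S₀.rawB {g} c₁ (fun k => θ ^ k)) → (∀ k, r₀ ≤ S₀.rOp k) →
      (∀ g ∈ W, (step S₀ E₀ cB).InsertionRate {g} κ E₀ δ' θ) →
      (∀ g ∈ W, TermBoundLoc (ballClass (selfCtr (assemblyOn (restrict S₀ M hMA hMB)).raw
        (assemblyOn (restrict S₀ M hMA hMB)).histRef) ROp RHist) (term (assemblyOn (restrict S₀ M hMA hMB)).𝒯
          (assemblyOn (restrict S₀ M hMA hMB)).inc (restrict S₀ M hMA hMB).act) {g} κ (a g)) →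
      (∀ g ∈ W, TermBudgetLoc (a g) G) →
      (∀ g ∈ W, TermLineAnalytic (ballClass (selfCtr (assemblyOn (restrict S₀ M hMA hMB)).raw
        (assemblyOn (restrict S₀ M hMA hMB)).histRef) ROp RHist)
        (term (assemblyOn (restrict S₀ M hMA hMB)).𝒯 (assemblyOn (restrict S₀ M hMA hMB)).inc (restrict S₀ M hMA hMB).act) {g}) →
      (∀ k, S₀.rOp k ≤ ROp k) → (∀ k, (assembly S₀).bHist E₀ cB k + S₀.rHist k ≤ RHist k) →
      NE5 (B13StepOfRecord.outA S₀ E₀ cB) (B13StepOfRecord.outB S₀ E₀ cB) W κ θ' C₅ := by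
  obtain ⟨C₅, h⟩ :=
    uniform_ne5_of_record_restrict_loc (κ := κ) hE₀ hG hcA hcB hc₁ hr₀ hδ' hθ0 hθ1 hθθ' hθ'1 hω hω1 hh hsmall
  refine ⟨C₅, ?_⟩
  intro 𝔾 _ R E IOp Hist _ _ S₀ M hMA hMB W ROp RHist a hSω hT hbB hbA hdA hdB hRA hRB hwer hfl hins hbd hbud hline hOp hHist
  exact ne5_of_forall_singleton fun g hg =>
    h S₀ M hMA hMB hSω (hT g hg) (hbB g hg) (hbA g hg) (hdA g hg) (hdB g hg) (hRA g hg) (hRB g hg) (hwer g hg) hfl (hins g hg)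
      (hbd g hg) (hbud g hg) (hline g hg) hOp hHist

end Windowwise

end Summit.QuantumFields.BalabanUV.T4Continuum.B13StepEndSubArithmetic

end
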